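import Mathlib
import HarnessLib
import Summits.CriticalPhenomena.PercolationContinuityZ3.Theses.PercNearOneGluing

/-!
# Sketch — crux-ideate stmt-CriticalPhenomena-4575 (NoHeavyLowerTail), ideator 1, round 1

First-lemma signatures for the two idea cards
`Ideas/bhk-superadditivity-thinning.md` and `Ideas/hub-transfer-crux-equals-conj3.md`.
Everything is stated over existing declarations
(`Literature.Probability.LatticeModels.prodBernoulli`, `Literature.Probability.Percolation.openConn`,
and the route decls `…Theses.PercNearOneGluing.{NearOneGluing, NoHeavyLowerTail, AdditiveGluing}`).
Nothing here is proved; these are `Prop`s (no `sorry`).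
-/

namespace Summit.CriticalPhenomena.PercolationContinuityZ3.Cruxes.NoHeavyLowerTail.Sketch

open scoped Classical
open MeasureTheory
open Literature.Probability.LatticeModels (prodBernoulli)
open Literature.Probability.Percolation (openConn)
open Summit.CriticalPhenomena.PercolationContinuityZ3.Theses.PercNearOneGluing
  (NearOneGluing NoHeavyLowerTail AdditiveGluing)

/-- The isolation event `{r ↮ R \ {r}}`: `r` is joined by an open path to no other point of `R`. -/
def isolated {n : ℕ} (R : Finset (Fin n)) (r : Fin n) : Set (Set (Sym2 (Fin n))) :=
  {ω | ∀ r' ∈ R, r' ≠ r → ω ∉ openConn r r'}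

/-- `N_R(ω) = |C(o) ∩ R|`, the number of points of `R` joined to `o`. -/
noncomputable def nConn {n : ℕ} (R : Finset (Fin n)) (o : Fin n) (ω : Set (Sym2 (Fin n))) : ℕ :=
  (R.filter fun r => ω ∈ openConn o r).card

/-! ## Card A — BHK superadditivity + thinning -/

/-- FIRST LEMMA of card A (Kozma–Nitzan arXiv:2401.12397 Lemma 2 with singleton blocks; follows
from van den Berg–Häggström–Kahn 2006 Thm 1.3 + Harris): for every finite weighted graph, every
finite `R` and every vertex `o`,  `Σ_{r∈R} P(o ↔ r | r ↮ R∖{r}) ≤ P(o ↔ R)`.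
(Division by a zero isolation probability gives 0 in Lean, matching the convention that such
terms are dropped.) -/
def SingletonSuperadditivity : Prop :=
  ∀ (n : ℕ) (w : Sym2 (Fin n) → unitInterval) (R : Finset (Fin n)) (o : Fin n),
    ∑ r ∈ R, (prodBernoulli w).real (openConn o r ∩ isolated R r) /
        (prodBernoulli w).real (isolated R r)
      ≤ (prodBernoulli w).real (⋃ r ∈ R, openConn o r)

/-- Corollary (singleton pocket bound): `P(|C(o) ∩ R| = 1) ≤ max_r P(r ↮ R∖r) · P(o ↔ R)`. -/
def SingletonPocketBound : Prop :=
  ∀ (n : ℕ) (w : Sym2 (Fin n) → unitInterval) (R : Finset (Fin n)) (o : Fin n) (δ : ℝ),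
    (∀ r ∈ R, (prodBernoulli w).real (isolated R r) ≤ δ) →
    (prodBernoulli w).real {ω | nConn R o ω = 1} ≤ δ * (prodBernoulli w).real (⋃ r ∈ R, openConn o r)

/-- THEOREM D (log-scale lower tail; no hypothesis on `o`): if every `a ∈ A` has
`P(a ↔ a₀) ≥ 1 - δ` then for `t ≥ 2`,
`P(o ↮ a₀, 1 ≤ |C(o) ∩ (A∖a₀)| < t) ≤ 8 δ ⌈log₂ t⌉`. -/
def LogScaleLowerTail : Prop :=
  ∀ (n : ℕ) (w : Sym2 (Fin n) → unitInterval) (A : Finset (Fin n)) (o a₀ : Fin n) (δ : ℝ) (t : ℕ),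
    a₀ ∈ A → 2 ≤ t → (∀ a ∈ A, 1 - δ ≤ (prodBernoulli w).real (openConn a a₀)) →
    (prodBernoulli w).real
        {ω | ω ∉ openConn o a₀ ∧ 1 ≤ nConn (A.erase a₀) o ω ∧ nConn (A.erase a₀) o ω < t}
      ≤ 8 * δ * (Nat.clog 2 t : ℝ)

/-- Corollary: Kozma–Nitzan Conjecture 3 / AdditiveGluing up to a `log |A|` factor. -/
def LogNearOneGluing : Prop :=
  ∀ (n : ℕ) (w : Sym2 (Fin n) → unitInterval) (A : Finset (Fin n)) (o b : Fin n) (δ : ℝ),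
    1 - δ ≤ (prodBernoulli w).real (⋃ a ∈ A, openConn o a) →
    (∀ a ∈ A, 1 - δ ≤ (prodBernoulli w).real (openConn a b)) →
    1 - δ * (1 + 8 * (Nat.clog 2 (A.card + 1) : ℝ)) ≤ (prodBernoulli w).real (openConn o b)

/-- TRANSFER `C⁺` of card A (conjecture LLT, linear lower tail, no hypothesis on `o`):
`P(1 ≤ |C(o) ∩ A| < |A|/2) ≤ C · max_{a,a'} P(a ↮ a')`. Finitely refutable; implies the crux. -/
def LinearLowerTail : Prop :=
  ∃ C : ℝ, ∀ (n : ℕ) (w : Sym2 (Fin n) → unitInterval) (A : Finset (Fin n)) (o : Fin n) (δ : ℝ),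
    (∀ a ∈ A, ∀ a' ∈ A, 1 - δ ≤ (prodBernoulli w).real (openConn a a')) →
    (prodBernoulli w).real {ω | 1 ≤ nConn A o ω ∧ 2 * nConn A o ω < A.card} ≤ C * δ

/-- Glue of the transfer: LLT gives the crux (take `δ = min (ε/2) (ε/(2C))`). -/
def LinearLowerTailSuffices : Prop := LinearLowerTail → NoHeavyLowerTail

/-! ## Card B — hub transfer: the crux *is* Conjecture 3 -/

/-- FIRST LEMMA of card B (converse of support 4577, provable now: `X` at `b := a₀ ∈ A`, Markov on
`|A| - |C(a₀) ∩ A|`, transitivity of `↔`): -/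
def CruxOfNearOneGluing : Prop := NearOneGluing → NoHeavyLowerTail

/-- Star normal form of Conjecture 3 (PFS): set-reliability of `o` plus star-reliability of `A`
to one hub `a₀` forces point-reliability of `o` to the hub. Equivalent to `NearOneGluing`. -/
def PointFromSet : Prop :=
  ∀ ε : ℝ, 0 < ε → ∃ δ : ℝ, 0 < δ ∧ ∀ (n : ℕ) (w : Sym2 (Fin n) → unitInterval) (A : Finset (Fin n))
    (o a₀ : Fin n), a₀ ∈ A →
    1 - δ < (prodBernoulli w).real (⋃ a ∈ A, openConn o a) →
    (∀ a ∈ A, 1 - δ < (prodBernoulli w).real (openConn a a₀)) →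
    1 - ε < (prodBernoulli w).real (openConn o a₀)

def PointFromSet_iff : Prop := PointFromSet ↔ NearOneGluing

/-- Conditional Harris-product bound (BHK Thm 1.3: `C_o` is positively associated given
`{o ↮ a₀}`): with `ψ = P(o ↮ a₀)`, `P(o ↮ A) ≤ δ ≤ ψ/2` and star reliability `δ₀ ≤ ψ/2`,
`ψ · log (ψ/δ) ≤ (7/5) · δ₀ · Σ_a P(o ↔ a)`. -/
def ConditionalHarrisProduct : Prop :=
  ∀ (n : ℕ) (w : Sym2 (Fin n) → unitInterval) (A : Finset (Fin n)) (o a₀ : Fin n) (δ δ₀ : ℝ),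
    a₀ ∈ A → 0 < δ →
    (prodBernoulli w).real (⋃ a ∈ A, openConn o a)ᶜ ≤ δ →
    (∀ a ∈ A, (prodBernoulli w).real (openConn a a₀)ᶜ ≤ δ₀) →
    2 * δ ≤ (prodBernoulli w).real (openConn o a₀)ᶜ →
    2 * δ₀ ≤ (prodBernoulli w).real (openConn o a₀)ᶜ →
    (prodBernoulli w).real (openConn o a₀)ᶜ *
        Real.log ((prodBernoulli w).real (openConn o a₀)ᶜ / δ)
      ≤ 7 / 5 * δ₀ * ∑ a ∈ A, (prodBernoulli w).real (openConn o a)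

end Summit.CriticalPhenomena.PercolationContinuityZ3.Cruxes.NoHeavyLowerTail.Sketch
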